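import Summits.ResolutionOfSingularities.ResolutionOfSingularities.Theorems.FrobeniusClosingPatchingRelPerfectDepthHSepCJSStep
import Summits.ResolutionOfSingularities.ResolutionOfSingularities.Theorems.FrobeniusClosingPatchingRelPerfectDepthWeightTwoBCJS
import Literature.AlgebraicGeometry.Resolution.EmbeddedResolutionExcellentSurfacesSequence
import Literature.AlgebraicGeometry.Resolution.RegularCentreComponents
import Literature.AlgebraicGeometry.Resolution.NormalCrossingsStrictification
import Literature.AlgebraicGeometry.Resolution.MarkedIdealsEtale
import Literature.Topology.KrullDimensionDrop
import HarnessLib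

/-!
# Crux `PatchingRelPerfect` (stmt-ResolutionOfSingularities-16161), chain W5.2 — rung R5ᴴ, hand N3 «CJS transport on the carrier»:
# the PIECES LOOP, the TRANSPORT along a CJS sequence, and the transport MODULO F-32bR

[OURS · L1 W5.2 · R5ᴴ N3 (owner res-D-pv-055, targets `…DepthTargetsR5H` p535426; hand res-D-pv-054)] Fact-free except the named
antecedent `CossartJannsenSaito2020EmbeddedSequenceB` (F-32bR) of the last theorem; NOT statements of the manuscript under review
(Hironaka 2017); AI-written, weaker than expert review.
* `pieces_loop` — a regular CJS centre `V(C)` is blown up piece by piece (`IsBlowup.exists_comp_eq_of_isPiecePartition_cons`), one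
  `HSepSeq.cons` per piece (`HSepCJS.piece_single`), the data of the remaining pieces transported (`centre_transport`); bookkeeping
  `τ⁻¹(Supp D ∖ V(C)) ⊆ Supp D' ⊆ τ⁻¹(Supp D)`, new exceptional members over `B₀ ⊇ ⋃ Supp ℰ ∪ V(C)` and covering its preimage.
* `cjs_transport` — ISO-TOLERANT induction over `IsBPermissibleSequenceB (Supp D) ∅ σ X' B'` (pattern: res-D-pv-054's
  `SepCJS.cjs_transport`, res-D-pv-052's `WeightTwoB.Nr.cjs_transport`): the sequence is carried to `HSepSeq ρ [(D, ℓ)] ((D₁, ℓ) :: ℰ₁)`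
  on `W₁ ≅ Z'` over `W` (`e.hom ≫ σ = ρ`), `W₁` regular, `D₁` effective Cartier, `boundaryOf ℰ₁` snc, `e⁻¹ X' ⊆ Supp D₁ ⊆ ρ⁻¹ Supp D`
  (so every later CJS centre, inside the strict transform `X'`, is LEGAL), the exceptional members drawn on `e⁻¹ B'` and covering it;
  a CJS centre is regular with normal crossings with `B'`, hence snc with `boundaryOf ℰ₁` (`hasSNCWith_comap_of_isNormalCrossingWith`);
  no order hypothesis is needed (contrast Phase A's ORD2).
* `transport_of_cjsB` — MODULO F-32bR, for `W` integral Noetherian regular excellent of dimension three, `D` effective Cartier,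
  `ℓ ≥ 1`: an `HSepSeq` from `[(D, ℓ)]` to `(D₁, ℓ) :: ℰ₁` on `W₁` with the CJS END clauses (`X₁` closed, `𝓘(cl X₁)` a regular
  subscheme, `IsTransversalWith Z₁ X₁ B₁`, `B₁` an sncd, `e⁻¹X₁ ⊆ Supp D₁ ⊆ e⁻¹X₁ ∪ ⋃ Supp ℰ₁`, `ℰ₁` on / covering `e⁻¹B₁`).

## References
* V. Cossart, U. Jannsen, S. Saito, LNM 2270 (2020), Thm. 1.4, (6.2), Def. 4.1, Thm. 6.9 (a). [CossartJannsenSaito2020]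
* J. Kollár, *Lectures on Resolution of Singularities* (2007), 3.30.2, (3.111) Steps 1–3. [Kollar2007]
* E. Bierstone, D. Grigoriev, P. Milman, J. Włodarczyk (2011), Def. 3.1.3, §4 Step 2b. [BierstoneGrigorievMilmanWlodarczyk2011]
* The Stacks Project, Tag 080A. [StacksProject]
-/

-- `Summit.<Summit>.<Sub>.Theorems` with `Sub = Summit` (single-conjunct summit, D-0017)
set_option linter.dupNamespace false

noncomputable section

open CategoryTheory CategoryTheory.Limits AlgebraicGeometry TopologicalSpace IsLocalRing
open Literature.AlgebraicGeometry.Resolution Scheme.IdealSheafData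

namespace Summit.ResolutionOfSingularities.ResolutionOfSingularities.Theorems

universe u

namespace HSepCJS

open DepthSNC DepthTargets WeightTwoB

/-! ## §1 The initial state -/

/-- The initial state `[(D, ℓ)]` has no exceptional member: `boundaryOf [] = []` is snc on a regular scheme. [folklore] -/
theorem hasSNC_boundaryOf_nil {W : Scheme.{u}} [IsLocallyNoetherian W] (hW : Scheme.IsRegular W) :
    HasSNC (boundaryOf ([] : List (W.IdealSheafData × ℕ))) := by
  simpa [boundaryOf] using hasSNCWith_nil_of_isRegular hW (isRegular_subscheme_top (X := W))

/-! ## §2 The pieces loop -/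

/-- The induction behind `pieces_loop`, on the number of pieces. [cite: BierstoneGrigorievMilmanWlodarczyk2011, §4 Step 2b] -/
private theorem pieces_loop_aux {W₀ : Scheme.{u}} {𝒟₀ : List (W₀.IdealSheafData × ℕ)} {ℓ : ℕ} (hℓ : 1 ≤ ℓ) (n : ℕ) :
    ∀ {W : Scheme.{u}} [IsIntegral W] [IsNoetherian W] {ρ : W ⟶ W₀}
      {D : W.IdealSheafData} {ℰ : List (W.IdealSheafData × ℕ)} (_hW : Scheme.IsRegular W) (_hD : IsEffectiveCartier D)
      (_hℰ : HasSNC (boundaryOf ℰ)) (_hseq : HSepSeq ρ 𝒟₀ ((D, ℓ) :: ℰ))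
      {C : W.IdealSheafData} (_hC : Scheme.IsRegular C.subscheme)
      {Zs : List (Closeds W)} (_hlen : Zs.length = n) (_hne : Zs ≠ []) (_hP : IsPiecePartition C Zs)
      (_hΓ : ∀ Z ∈ Zs, IsIrreducible (Z : Set W) ∧ Scheme.IsRegular (vanishingIdeal Z).subscheme ∧
        (Z : Set W) ⊆ D.support ∧ HasSNCWith (boundaryOf ℰ) (vanishingIdeal Z))
      {B₀ : Set W} (_hℰB : ∀ p ∈ ℰ, (p.1.support : Set W) ⊆ B₀) (_hCB : (C.support : Set W) ⊆ B₀)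
      (_hcov : ∀ x ∈ B₀, (∃ p ∈ ℰ, x ∈ p.1.support) ∨ x ∈ (C.support : Set W))
      {W' : Scheme.{u}} {τ : W' ⟶ W} (_hτ : IsBlowup τ C),
      ∃ (_ : IsIntegral W') (_ : IsNoetherian W') (D' : W'.IdealSheafData) (ℰ' : List (W'.IdealSheafData × ℕ)),
        HSepSeq (τ ≫ ρ) 𝒟₀ ((D', ℓ) :: ℰ') ∧ Scheme.IsRegular W' ∧ IsEffectiveCartier D' ∧ HasSNC (boundaryOf ℰ') ∧
        τ ⁻¹' ((D.support : Set W) \ (C.support : Set W)) ⊆ (D'.support : Set W') ∧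
        ((D'.support : Set W') ⊆ τ ⁻¹' (D.support : Set W)) ∧
        (∀ p ∈ ℰ', (p.1.support : Set W') ⊆ τ ⁻¹' B₀) ∧
        (∀ x' : W', τ x' ∈ B₀ → ∃ p ∈ ℰ', x' ∈ p.1.support) := by
  induction n with
  | zero =>
    intro W _ _ ρ D ℰ hW hD hℰ hseq C hC Zs hlen hne
    exact absurd (List.eq_nil_of_length_eq_zero hlen) hne
  | succ n ih =>
    intro W _ _ ρ D ℰ hW hD hℰ hseq C hC Zs hlen hne hP hΓ B₀ hℰB hCB hcov W' τ hτ
    obtain ⟨Z, Zs', rfl⟩ : ∃ Z Zs', Zs = Z :: Zs' := by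
      cases Zs with
      | nil => exact absurd rfl hne
      | cons Z Zs' => exact ⟨Z, Zs', rfl⟩
    have hlen' : Zs'.length = n := by simpa using hlen
    have hZC : (Z : Set W) ⊆ (C.support : Set W) := by
      rw [← hP.2]
      exact Set.subset_iUnion₂ (s := fun (Z' : Closeds W) (_ : Z' ∈ Z :: Zs') => (Z' : Set W)) Z List.mem_cons_self
    have hZB : (Z : Set W) ⊆ B₀ := hZC.trans hCB
    by_cases hnil : Zs' = []
    · -- ONE piece: `C = 𝓘(Z)`
      subst hnil
      have hCZ : C = vanishingIdeal Z := by
        rw [← prod_pieceIdeals_eq_of_isRegular hC hP]; simp [pieceIdeals]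
      subst hCZ
      obtain ⟨hirr, hZ, hZD, hsnc⟩ := hΓ Z List.mem_cons_self
      obtain ⟨hint', hnoeth', e, hseq', hW', hD', hℰ', hlow, hup, hbd, hcov'⟩ :=
        piece_single hW hD hℓ hseq hirr hZ hZD hsnc hℰB hZB hτ
      refine ⟨hint', hnoeth', _, _, hseq', hW', hD', hℰ', ?_, hup, hbd, fun x' hx' => hcov' x' ?_⟩
      · rw [Scheme.IdealSheafData.coe_support_vanishingIdeal]; exact hlow
      · rcases hcov (τ x') hx' with h | h
        · exact Or.inl h
        · right; rwa [Scheme.IdealSheafData.coe_support_vanishingIdeal] at h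
    · -- SEVERAL pieces: blow up the first, transport the rest
      obtain ⟨X₁, τ₁, τ₂, hcomp, hτ₁, -, -, -, -, hτ₂, hC₁, hP₁⟩ := hτ.exists_comp_eq_of_isPiecePartition_cons hC hP
      obtain ⟨hirr, hZ, hZD, hsnc⟩ := hΓ Z List.mem_cons_self
      obtain ⟨hint₁, hnoeth₁, e, hseq₁, hW₁, hD₁, hℰ₁, hlow₁, hup₁, hbd₁, hcov₁⟩ :=
        piece_single hW hD hℓ hseq hirr hZ hZD hsnc hℰB hZB hτ₁
      haveI := hint₁
      haveI := hnoeth₁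
      -- the centre data of the lifted remaining pieces
      have hΓ₁ : ∀ Z₁ ∈ Zs'.map (fun W₁ : Closeds W => W₁.preimage τ₁.continuous),
          IsIrreducible (Z₁ : Set X₁) ∧ Scheme.IsRegular (vanishingIdeal Z₁).subscheme ∧
            (Z₁ : Set X₁) ⊆ (controlledTransform τ₁ (vanishingIdeal Z) D 1).support ∧
            HasSNCWith (boundaryOf (stepExp ℰ τ₁ (vanishingIdeal Z) e)) (vanishingIdeal Z₁) := by
        intro Z₁ hZ₁
        obtain ⟨Z₂, hZ₂, rfl⟩ := List.mem_map.mp hZ₁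
        obtain ⟨hirr₂, hZ₂reg, hZ₂D, hsnc₂⟩ := hΓ Z₂ (List.mem_cons_of_mem _ hZ₂)
        exact centre_transport hsnc hτ₁ hirr₂ hZ₂reg hZ₂D hsnc₂ (hP.disjoint_of_mem_tail hZ₂) e
      have hne₁ : Zs'.map (fun W₁ : Closeds W => W₁.preimage τ₁.continuous) ≠ [] := by
        simpa using hnil
      have hlen₁ : (Zs'.map (fun W₁ : Closeds W => W₁.preimage τ₁.continuous)).length = n := by simpa using hlen'
      -- the support of the remaining centre lies over `⋃ Zs' ⊆ V(C) ⊆ B₀`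
      set T : Set W := ⋃ Z₂ ∈ Zs', (Z₂ : Set W) with hT
      have hC₁supp : (((pieceIdeals (Zs'.map fun W₁ : Closeds W => W₁.preimage τ₁.continuous)).prod).support : Set X₁) =
          τ₁ ⁻¹' T := by
        rw [← hP₁.2, hT]
        ext x
        simp only [List.mem_map, Set.mem_iUnion, exists_prop, Set.mem_preimage]
        constructor
        · rintro ⟨_, ⟨Z₂, hZ₂, rfl⟩, hx⟩
          exact ⟨Z₂, hZ₂, hx⟩
        · rintro ⟨Z₂, hZ₂, hx⟩
          exact ⟨_, ⟨Z₂, hZ₂, rfl⟩, hx⟩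
      have hTC : T ⊆ (C.support : Set W) := by
        rw [← hP.2, hT]
        exact Set.iUnion₂_subset fun Z₂ hZ₂ =>
          Set.subset_iUnion₂ (s := fun (Z' : Closeds W) (_ : Z' ∈ Z :: Zs') => (Z' : Set W)) Z₂ (List.mem_cons_of_mem _ hZ₂)
      have hZT : (Z : Set W) ∪ T = (C.support : Set W) := by
        rw [← hP.2, hT]
        ext x
        simp only [Set.mem_union, Set.mem_iUnion, List.mem_cons, exists_prop]
        constructor
        · rintro (hx | ⟨Z₂, hZ₂, hx⟩)
          · exact ⟨Z, Or.inl rfl, hx⟩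
          · exact ⟨Z₂, Or.inr hZ₂, hx⟩
        · rintro ⟨Z', rfl | hZ', hx⟩
          · exact Or.inl hx
          · exact Or.inr ⟨Z', hZ', hx⟩
      have hCB₁ : (((pieceIdeals (Zs'.map fun W₁ : Closeds W => W₁.preimage τ₁.continuous)).prod).support : Set X₁) ⊆
          τ₁ ⁻¹' B₀ := by
        rw [hC₁supp]; exact Set.preimage_mono (hTC.trans hCB)
      -- the cover of `τ₁⁻¹ B₀` by the new exceptional members and the remaining centre
      have hcov₁' : ∀ x₁ ∈ τ₁ ⁻¹' B₀, (∃ p ∈ stepExp ℰ τ₁ (vanishingIdeal Z) e, x₁ ∈ p.1.support) ∨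
          x₁ ∈ ((((pieceIdeals (Zs'.map fun W₁ : Closeds W => W₁.preimage τ₁.continuous)).prod).support : Set X₁)) := by
        intro x₁ hx₁
        rcases hcov (τ₁ x₁) hx₁ with h | h
        · exact Or.inl (hcov₁ x₁ (Or.inl h))
        · rw [← hZT] at h
          rcases h with h | h
          · exact Or.inl (hcov₁ x₁ (Or.inr h))
          · right; rw [hC₁supp]; exact h
      obtain ⟨hint', hnoeth', D', ℰ', hseq', hW', hD', hℰ', hlow', hup', hbd', hcov'⟩ :=
        ih hW₁ hD₁ hℰ₁ hseq₁ hC₁ hlen₁ hne₁ hP₁ hΓ₁ hbd₁ hCB₁ hcov₁' hτ₂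
      have hτx : ∀ x' : W', τ x' = τ₁ (τ₂ x') := fun x' => by
        rw [← hcomp]; simp only [Scheme.Hom.comp_base, TopCat.coe_comp, Function.comp_apply]
      refine ⟨hint', hnoeth', D', ℰ', ?_, hW', hD', hℰ', ?_, ?_, ?_, ?_⟩
      · rw [← hcomp, Category.assoc]; exact hseq'
      · -- lower bound through the two blow-ups
        intro x' hx'
        have hxD : τ₁ (τ₂ x') ∈ (D.support : Set W) := by rw [← hτx]; exact hx'.1
        have hxC' : τ₁ (τ₂ x') ∉ (C.support : Set W) := by rw [← hτx]; exact hx'.2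
        rw [← hZT, Set.mem_union, not_or] at hxC'
        refine hlow' ⟨hlow₁ ⟨hxD, hxC'.1⟩, ?_⟩
        rw [hC₁supp]
        exact hxC'.2
      · -- upper bound
        intro x' hx'
        rw [Set.mem_preimage, hτx]
        exact hup₁ (hup' hx')
      · intro p hp x' hx'
        have h1 := hbd' p hp hx'
        rw [Set.mem_preimage, hτx]
        exact h1
      · intro x' hx'
        refine hcov' x' ?_
        have hx'' : τ₁ (τ₂ x') ∈ B₀ := by rw [← hτx]; exact hx'
        exact hx''

/-- [OURS · L1 W5.2 · R5ᴴ N3] **THE PIECES LOOP**: a regular CJS centre `V(C)` with pieces `Zs ≠ []`, each carrying the centre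
datum (irreducible, regular, inside `Supp D`, snc with `ℰ`), is blown up (`τ`, along `C`) as a composition of `HSepSeq.cons` moves, one per piece; the new state, the
bounds `τ⁻¹(Supp D ∖ V(C)) ⊆ Supp D' ⊆ τ⁻¹(Supp D)`, the boundary bound and the boundary cover.
[cite: BierstoneGrigorievMilmanWlodarczyk2011, §4 Step 2b, Def. 3.1.3] [cite: CossartJannsenSaito2020, Thm. 1.4, (6.2)]
[cite: StacksProject, Tag 080A] -/
theorem pieces_loop {W₀ W : Scheme.{u}} [IsIntegral W] [IsNoetherian W] {ρ : W ⟶ W₀} {𝒟₀ : List (W₀.IdealSheafData × ℕ)}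
    {ℓ : ℕ} (hℓ : 1 ≤ ℓ) {D : W.IdealSheafData} {ℰ : List (W.IdealSheafData × ℕ)} (hW : Scheme.IsRegular W)
    (hD : IsEffectiveCartier D) (hℰ : HasSNC (boundaryOf ℰ)) (hseq : HSepSeq ρ 𝒟₀ ((D, ℓ) :: ℰ))
    {C : W.IdealSheafData} (hC : Scheme.IsRegular C.subscheme)
    {Zs : List (Closeds W)} (hne : Zs ≠ []) (hP : IsPiecePartition C Zs)
    (hΓ : ∀ Z ∈ Zs, IsIrreducible (Z : Set W) ∧ Scheme.IsRegular (vanishingIdeal Z).subscheme ∧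
      (Z : Set W) ⊆ D.support ∧ HasSNCWith (boundaryOf ℰ) (vanishingIdeal Z))
    {B₀ : Set W} (hℰB : ∀ p ∈ ℰ, (p.1.support : Set W) ⊆ B₀) (hCB : (C.support : Set W) ⊆ B₀)
    (hcov : ∀ x ∈ B₀, (∃ p ∈ ℰ, x ∈ p.1.support) ∨ x ∈ (C.support : Set W))
    {W' : Scheme.{u}} {τ : W' ⟶ W} (hτ : IsBlowup τ C) :
    ∃ (_ : IsIntegral W') (_ : IsNoetherian W') (D' : W'.IdealSheafData) (ℰ' : List (W'.IdealSheafData × ℕ)),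
      HSepSeq (τ ≫ ρ) 𝒟₀ ((D', ℓ) :: ℰ') ∧ Scheme.IsRegular W' ∧ IsEffectiveCartier D' ∧ HasSNC (boundaryOf ℰ') ∧
      τ ⁻¹' ((D.support : Set W) \ (C.support : Set W)) ⊆ (D'.support : Set W') ∧
      ((D'.support : Set W') ⊆ τ ⁻¹' (D.support : Set W)) ∧
      (∀ p ∈ ℰ', (p.1.support : Set W') ⊆ τ ⁻¹' B₀) ∧
      (∀ x' : W', τ x' ∈ B₀ → ∃ p ∈ ℰ', x' ∈ p.1.support) :=
  pieces_loop_aux hℓ Zs.length hW hD hℰ hseq hC rfl hne hP hΓ hℰB hCB hcov hτ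

/-! ## §3 The CJS induction -/

/-- [OURS · L1 W5.2 · R5ᴴ N3] **Transport along a CJS sequence** (see the module docstring): ISO-TOLERANT induction over
`IsBPermissibleSequenceB (Supp D) ∅ σ X' B'`. [cite: CossartJannsenSaito2020, Thm. 1.4, (6.2), Thm. 6.9 (a), Def. 4.1]
[cite: Kollar2007, (3.111) Step 3] -/
theorem cjs_transport {W : Scheme.{u}} [IsIntegral W] [IsNoetherian W] (hW : Scheme.IsRegular W)
    {D : W.IdealSheafData} (hD : IsEffectiveCartier D) {ℓ : ℕ} (hℓ : 1 ≤ ℓ) :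
    ∀ {Z' : Scheme.{u}} {σ : Z' ⟶ W} {X' B' : Set Z'},
      IsBPermissibleSequenceB (D.support : Set W) (∅ : Set W) σ X' B' →
      IsClosed X' ∧ ∃ (W₁ : Scheme.{u}) (_ : IsIntegral W₁) (_ : IsNoetherian W₁) (_ : IsNoetherian Z') (ρ : W₁ ⟶ W)
        (e : W₁ ≅ Z') (D₁ : W₁.IdealSheafData) (ℰ₁ : List (W₁.IdealSheafData × ℕ)),
        e.hom ≫ σ = ρ ∧ HSepSeq ρ [(D, ℓ)] ((D₁, ℓ) :: ℰ₁) ∧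
        Scheme.IsRegular W₁ ∧ IsEffectiveCartier D₁ ∧ HasSNC (boundaryOf ℰ₁) ∧
        e.hom ⁻¹' X' ⊆ (D₁.support : Set W₁) ∧ ((D₁.support : Set W₁) ⊆ ρ ⁻¹' (D.support : Set W)) ∧
        (∀ p ∈ ℰ₁, (p.1.support : Set W₁) ⊆ e.hom ⁻¹' B') ∧
        (∀ x : W₁, e.hom x ∈ B' → ∃ p ∈ ℰ₁, x ∈ p.1.support) := by
  intro Z' σ X' B' h
  induction h with
  | refl =>
    refine ⟨D.support.isClosed, W, inferInstance, inferInstance, inferInstance, 𝟙 W, Iso.refl W, D, [], by simp,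
      HSepSeq.nil [(D, ℓ)], hW, hD, hasSNC_boundaryOf_nil hW, ?_, fun x hx => ?_, fun p hp => by simp at hp,
      fun x hx => by simp at hx⟩
    · rw [Iso.refl_hom, preimage_id']
    · simpa using hx
  | @blowup Z' Z'' σ X' B' _ C τ hτ hreg hsub _ _ hnc ih =>
    obtain ⟨hX'c, W₁, hint, hnoeth, hnoethZ, ρ, e, D₁, ℰ₁, hρ, hseq, hW₁, hD₁, hℰ₁, hlow, hup, hbd, hcov⟩ := ih
    haveI := hint
    haveI := hnoeth
    haveI := hnoethZ
    haveI : IsNoetherian Z'' := isNoetherian_of_isBlowup hτ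
    have hclX : closure X' = X' := hX'c.closure_eq
    refine ⟨isClosed_closure, ?_⟩
    by_cases hC0 : C = ⊤
    · /- EMPTY centre: `τ` is an isomorphism, absorbed into `e` -/
      haveI := isIso_of_isBlowup_top hτ hC0
      have hCs : (C.support : Set Z') = ∅ := by
        rw [hC0, Scheme.IdealSheafData.support_top]; rfl
      refine ⟨W₁, hint, hnoeth, inferInstance, ρ, e ≪≫ (asIso τ).symm, D₁, ℰ₁, ?_, hseq, hW₁, hD₁, hℰ₁, ?_, hup,
        fun p hp => ?_, fun x hx => ?_⟩
      · rw [Iso.trans_hom, Iso.symm_hom, asIso_inv, Category.assoc, IsIso.inv_hom_id_assoc, hρ]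
      · rw [hCs, Set.sdiff_empty, (hX'c.preimage τ.continuous).closure_eq, Iso.trans_hom, Iso.symm_hom, asIso_inv, preimage_comp',
          preimage_inv_preimage]
        exact hlow
      · rw [hCs, Set.union_empty, Iso.trans_hom, Iso.symm_hom, asIso_inv, preimage_comp', preimage_inv_preimage]
        exact hbd p hp
      · refine hcov x ?_
        have hx' : x ∈ ⇑(e ≪≫ (asIso τ).symm).hom ⁻¹' (⇑τ ⁻¹' (B' ∪ (C.support : Set Z'))) := hx
        rw [hCs, Set.union_empty, Iso.trans_hom, Iso.symm_hom, asIso_inv, preimage_comp', preimage_inv_preimage] at hx'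
        exact hx'
    · /- NON-EMPTY centre: re-sequence along the pieces of `e^* C` on `W₁` -/
      have hCne : (C.support : Set Z').Nonempty := by
        rw [Set.nonempty_iff_ne_empty]
        intro h0
        apply hC0
        rw [← Scheme.IdealSheafData.support_eq_bot_iff]
        exact Closeds.ext h0
      have hC₀reg : Scheme.IsRegular (C.comap e.hom).subscheme := isRegular_subscheme_comap_of_isOpenImmersion e.hom C hreg
      have hτ₀ : IsBlowup (τ ≫ e.inv) (C.comap e.hom) := by
        have h := hτ.comp_iso e.symm
        rwa [Iso.symm_hom, Iso.symm_inv] at h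
      have hC₀s : ((C.comap e.hom).support : Set W₁) = e.hom ⁻¹' C.support := by
        rw [support_comap]; rfl
      have hCX : (C.support : Set Z') ⊆ X' := by
        intro y hy
        have h : y ∈ ((vanishingIdeal (⟨closure X', isClosed_closure⟩ : Closeds Z')).support : Set Z') :=
          support_antitone hsub hy
        rw [Scheme.IdealSheafData.coe_support_vanishingIdeal] at h
        change y ∈ closure X' at h
        rwa [hclX] at h
      have hC₀D : ((C.comap e.hom).support : Set W₁) ⊆ D₁.support := by
        rw [hC₀s]; exact (Set.preimage_mono hCX).trans hlow
      have hP : IsPiecePartition (C.comap e.hom) (Kollar2007.boundaryPieces (C.comap e.hom)) :=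
        isPiecePartition_boundaryPieces_of_isRegular hC₀reg
      have hne : Kollar2007.boundaryPieces (C.comap e.hom) ≠ [] := by
        intro h0
        rw [boundaryPieces_eq_nil_iff] at h0
        obtain ⟨y, hy⟩ := hCne
        have h : e.inv y ∈ ((C.comap e.hom).support : Set W₁) := by
          rw [hC₀s, Set.mem_preimage, hom_inv_apply]; exact hy
        rw [h0, Scheme.IdealSheafData.support_top] at h
        exact h
      -- the exceptional members have snc with the centre (CJS's normal crossings on `Z'`, pushed through `e`)
      have hsncC : HasSNCWith (boundaryOf ℰ₁) (C.comap e.hom) :=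
        hasSNCWith_comap_of_isNormalCrossingWith e hℰ₁
          (fun K hK => by obtain ⟨p, hp, rfl⟩ := List.mem_map.mp hK; exact hbd p hp)
          (eq_vanishingIdeal_support_of_isRegular C hreg) hnc
      -- the centre data of every piece
      have hΓ : ∀ Z ∈ Kollar2007.boundaryPieces (C.comap e.hom),
          IsIrreducible (Z : Set W₁) ∧ Scheme.IsRegular (vanishingIdeal Z).subscheme ∧
            (Z : Set W₁) ⊆ D₁.support ∧ HasSNCWith (boundaryOf ℰ₁) (vanishingIdeal Z) := fun Z hZ =>
        ⟨isIrreducible_of_mem_boundaryPieces hZ, isRegular_subscheme_vanishingIdeal_piece hC₀reg hP hZ,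
          fun x hx => hC₀D (hP.subset hZ hx), hsncC.centrePiece hP hZ⟩
      obtain ⟨hint'', hnoeth'', D'', ℰ'', hseq', hW'', hD'', hℰ'', hlow', hup', hbd', hcov'⟩ :=
        pieces_loop hℓ hW₁ hD₁ hℰ₁ hseq hC₀reg hne hP hΓ (B₀ := e.hom ⁻¹' (B' ∪ (C.support : Set Z')))
          (fun p hp => (hbd p hp).trans (Set.preimage_mono Set.subset_union_left))
          (by rw [hC₀s]; exact Set.preimage_mono Set.subset_union_right)
          (fun x hx => by
            rcases hx with hx | hx
            · exact Or.inl (hcov x hx)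
            · right; rwa [hC₀s])
          hτ₀
      have hτx : ∀ x : Z'', τ x = e.hom ((τ ≫ e.inv) x) := fun x => by
        simp only [Scheme.Hom.comp_base, TopCat.coe_comp, Function.comp_apply, hom_inv_apply]
      refine ⟨Z'', hint'', hnoeth'', inferInstance, (τ ≫ e.inv) ≫ ρ, Iso.refl Z'', D'', ℰ'', ?_, hseq', hW'', hD'', hℰ'',
        ?_, ?_, fun p hp => ?_, fun x hx => hcov' x ?_⟩
      · rw [Iso.refl_hom, Category.id_comp, ← hρ, Category.assoc, e.inv_hom_id_assoc]
      · -- lower bound: `cl τ⁻¹(X' ∖ V(C)) ⊆ Supp D''`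
        rw [Iso.refl_hom, preimage_id']
        refine closure_minimal (fun x hx => hlow' ⟨?_, ?_⟩) D''.support.isClosed
        · have h1 : e.hom ((τ ≫ e.inv) x) ∈ X' := by rw [← hτx]; exact hx.1
          exact hlow h1
        · rw [hC₀s, Set.mem_preimage, ← hτx]; exact hx.2
      · -- upper bound
        intro x hx
        have h1 := hup (hup' hx)
        simpa only [Set.mem_preimage, Scheme.Hom.comp_base, TopCat.coe_comp, Function.comp_apply] using h1
      · rw [Iso.refl_hom, preimage_id']
        refine (hbd' p hp).trans ?_
        rw [preimage_comp', preimage_inv_preimage_hom]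
      · rw [Iso.refl_hom] at hx
        rw [Set.mem_preimage, Scheme.Hom.comp_apply, hom_inv_apply]
        simpa using hx

/-! ## §4 The transport MODULO F-32bR -/

/-- [OURS · L1 W5.2 · R5ᴴ N3] **CJS ⇒ HSepSeq, with the END clauses** (MODULO F-32bR = `CossartJannsenSaito2020EmbeddedSequenceB`,
taken as a named antecedent): on an integral Noetherian regular excellent scheme `W` of dimension three, every effective Cartier
`D` with `ℓ ≥ 1` is carried by an `HSepSeq` from `[(D, ℓ)]` to a state `(D₁, ℓ) :: ℰ₁` on an integral Noetherian regular `W₁`, with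
an isomorphism `e : W₁ ≅ Z₁` onto CJS's end scheme such that: the end strict transform `X₁` (read on `W₁`) is closed, `𝓘(X₁)` is a
regular subscheme, `X₁ ⊆ Supp D₁ ⊆ X₁ ∪ ⋃ Supp ℰ₁`, the exceptional members are drawn on `e⁻¹ B₁` and cover it, and CJS's
transversality of `X₁ᶜᴶˢ` with the sncd `B₁` holds on `Z₁` (to be read through `e` by N4).  Route: `X = Supp D` is closed of dimension
`≤ 2` (`Literature.Topology.topologicalKrullDim_lt_of_isClosed_ssubset`), CJS (`.of_isClosed`), `cjs_transport`, CJS's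
`π⁻¹ X = X₁ ∪ B₁`. [cite: CossartJannsenSaito2020, Thm. 1.4, Thm. 6.9 (a), p. 7] [cite: Kollar2007, (3.111) Step 3] -/
theorem transport_of_cjsB (hCJS : CossartJannsenSaito2020EmbeddedSequenceB.{u}) (W : Scheme.{u}) [IsIntegral W] [IsNoetherian W]
    (hreg : Scheme.IsRegular W) (hexc : Scheme.IsExcellent W) (hdim : topologicalKrullDim W = 3) (D : W.IdealSheafData)
    (hD : IsEffectiveCartier D) (ℓ : ℕ) (hℓ : 1 ≤ ℓ) :
    ∃ (W₁ Z₁ : Scheme.{u}) (ρ : W₁ ⟶ W) (_ : IsIntegral W₁) (_ : IsNoetherian W₁) (_ : IsNoetherian Z₁) (e : W₁ ≅ Z₁)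
      (X₁ B₁ : Set Z₁) (D₁ : W₁.IdealSheafData) (ℰ₁ : List (W₁.IdealSheafData × ℕ)),
      HSepSeq ρ [(D, ℓ)] ((D₁, ℓ) :: ℰ₁) ∧ Scheme.IsRegular W₁ ∧ IsEffectiveCartier D₁ ∧ HasSNC (boundaryOf ℰ₁) ∧
      IsClosed X₁ ∧
      Scheme.IsRegular (vanishingIdeal ⟨closure X₁, isClosed_closure⟩).subscheme ∧ IsTransversalWith Z₁ X₁ B₁ ∧
      IsStrictNormalCrossingsDivisor Z₁ B₁ ∧ e.hom ⁻¹' X₁ ⊆ (D₁.support : Set W₁) ∧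
      ((D₁.support : Set W₁) ⊆ e.hom ⁻¹' X₁ ∪ ⋃ p ∈ ℰ₁, (p.1.support : Set W₁)) ∧
      (∀ p ∈ ℰ₁, (p.1.support : Set W₁) ⊆ e.hom ⁻¹' B₁) ∧
      (∀ x : W₁, e.hom x ∈ B₁ → ∃ p ∈ ℰ₁, x ∈ p.1.support) := by
  -- `X = Supp D` is closed, `≠ W`, of dimension `≤ 2`
  set X : Set W := (D.support : Set W) with hXdef
  have hXc : IsClosed X := D.support.isClosed
  have hXne : X ≠ Set.univ := by
    intro hX
    have h := hD.dense_compl_support.nonempty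
    rw [← hXdef, hX, Set.compl_univ] at h
    exact Set.not_nonempty_empty h
  have hdimX : topologicalKrullDim X ≤ 2 := by
    have hlt := Literature.Topology.topologicalKrullDim_lt_of_isClosed_ssubset hXc hXne (2 + 1)
      (by rw [hdim]; exact_mod_cast (by norm_num : (3 : ℕ) < 2 + 1 + 1))
    rw [Nat.cast_add_one] at hlt
    exact_mod_cast (ENat.WithBot.lt_add_one_iff.mp hlt)
  -- CJS: the `𝓑`-permissible sequence over `X` and its end clauses
  obtain ⟨Z₁, π, X₁, B₁, hT, -, -, -, -, hX₁, hB₁, htot, htr⟩ := hCJS.of_isClosed W hreg hexc X hXc hdimX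
  obtain ⟨hX₁c, W₁, hint, hnoeth, hnoethZ, ρ, e, D₁, ℰ₁, hρ, hseq, hW₁, hD₁, hℰ₁, hlow, hup, hbd, hcov⟩ :=
    cjs_transport hreg hD hℓ hT
  refine ⟨W₁, Z₁, ρ, hint, hnoeth, hnoethZ, e, X₁, B₁, D₁, ℰ₁, hseq, hW₁, hD₁, hℰ₁, hX₁c, hX₁, htr, hB₁, hlow, fun x hx => ?_,
    hbd, hcov⟩
  -- `Supp D₁ ⊆ ρ⁻¹ X = e⁻¹ π⁻¹ X = e⁻¹ (X₁ ∪ B₁)`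
  have h1 : e.hom x ∈ π ⁻¹' X := by
    have h := hup hx
    rw [← hρ] at h
    simpa only [Set.mem_preimage, Scheme.Hom.comp_base, TopCat.coe_comp, Function.comp_apply] using h
  rw [htot] at h1
  rcases h1 with h1 | h1
  · exact Or.inl h1
  · obtain ⟨p, hp, hxp⟩ := hcov x h1
    exact Or.inr (Set.mem_iUnion₂.mpr ⟨p, hp, hxp⟩)

end HSepCJS

end Summit.ResolutionOfSingularities.ResolutionOfSingularities.Theorems

end
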